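import Summits.QuantumFields.YangMills.Theorems.BalabanUVNodesN20HellingerRoadNullClassesKernel

/-!
# BalabanUVNodes ∕ node N20 (NE7b) — THE HELLINGER ROAD's ENDPOINT WITH NULL ∕ ONE-SIDED CLASSES, THE ROAD: `HybridNE7` with no bad class from (H) + (R′) + ((R‑c) or
# a bounded current) for NON-NEGATIVE class weights, head = a two-sided live class at every key and source; null ∕ one-sided classes are absorbed by the misfit shells

Cell `pub-ymgap` (HUMAN RULING D-0062 Track A ∕ director-ym R399 (3a) width seats), WIDTH SEAT `pub-ymgap-dag-n20-w5` (node n20 = NE7b), generation g6,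
CLAIM-2 ∕ INTENT-2b (bus).  Key item K3⁸ `SpineGivenEndpointR13SepCoPHV` (stmt-QuantumFields-27366; skeleton of record v6 b4e55110ab73e679, stub `stub_expansion13HV`),
K3⁷ stmt-QuantumFields-20544 aside; filed `--kind proof --supports … --as helper`.  COUNT-NEUTRAL.  THEOREMS ONLY (0 `def`, 0 `instance`, 0 `notation`, 0 `sorry`).
ADDITIVE — imports this seat's `…N20HellingerRoadNullClassesKernel` (INTENT-2a: Fermat's null rule, the response kernel, the target and the strict TV budget for `0 ≤ A, B`;
through it p626582 ∕ p623765 ∕ p619159 and dag-n20-w4's p609004 `exists_hybridNE7_of_target_of_classLawTV`) — cited BY NAME; modifies nothing.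

WHY.  The kernel file explains the defect of the road of record at the reading of record (one-sided σ-keys carry a class weight `≡ 0` under one run off the flow
agreement; strict positivity cannot be keyed there) and repairs the one-key analysis.  THIS FILE re-issues the three ∃-capstones of p623765 ∕ p626582 under `0 ≤ A`,
`0 ≤ B` at every source, with the two-sided-live-class head in place of strict positivity; p609004's misfit shells then swallow every null ∕ one-sided class (its core
inequality reads `0 ≤ 0 ≤ 0` there).  These are the sockets this seat's CLAIM-3 keys per guarded admissible tuple at `crOfRecord₁₃V`'s carriers, where non-negativity,
positive totals and the E1∕E2 dictionary are theorems of the tree.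
* §1 ★ `twoSided_of_hybridNE7` (the head is NECESSARY: any `HybridNE7` certificate with non-negative weights and positive totals forces a two-sided live class at every
  `(K, t)` — p609004's `exists_tvRadius_of_hybridNE7` on the run-B-null set) · ★★★ `exists_hybridNE7_of_endpointLetters_noHead_of_nonneg` — carriers `T K`; `A, B ≥ 0` at every source, differentiable on `|s| ≤ l₀` (`0 ≤ l₀`, `0 < vol`); a
  two-sided live class at every `(K, t)` on the window; the E1∕E2 dictionary; (H) with `Σ√η < ∞`; (R′) with `Σ R₁ < ∞`; (R‑c) ⇒ `∃ Wsh shA shB`, `0 ≤ Wsh ≤ √(2η)`, `Wsh < 1`,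
  `HybridNE7 l₀ vol T A B ∅ 0 shA shB Wsh (K ↦ l₀·(R₁ K + 2√(2η_K)√χ)∕vol)` · ★★★ `exists_hybridNE7_of_affinityDefectLetter_and_response_of_nonneg` ((H) in the ∃-shape
  of the landed suppliers) · ★★ `exists_hybridNE7_of_affinityDefectLetter_response_boundedCurrent_of_nonneg` ((R‑c) replaced by `|A'| ≤ M·A`).
* §2 A6 toys: `toy_oldRoad_hB_fails` (two classes on `Bool`, class `false` NULL under run B: the road of record's `hB` is FALSE on this carrier) · ★ `toy_hybridNE7_oneNullClass`
  (every antecedent of §1's ∃-shape road met on that carrier — one-sided run-A mass `4^{−K}`, dictionary `Z K = 1 + 4^{−K}`, zero currents, `η_K = 4^{−K}`, `R₁ = χ = 0` —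
  and `HybridNE7` EXHIBITED; not ex falso).

HONEST FRAMING.  [folklore] by-name transfer through the kernel file and p609004 on the tree's SHAPES; NO estimate of the programme is proved; every letter ((H), (R′),
(R‑c), bounded current, differentiability, the two-sided live class) is a HYPOTHESIS produced by nobody — (H)∕(R′) are the two-run content, UNPRINTED for d = 4; nothing of
Bałaban's asserted or instantiated (no `Provisos₁₃SepCoPH` tuple — K0⁷ OPEN); NE7 ∕ NE7b ∕ NE7c NOT PRINTED as two-run statements for d = 4 and NOT proved; N19′ ∕ N20 ∕ N21
NOT discharged; K3⁸ OPEN (v6 STANDS), K3⁷ aside, neither claimed; no summit statement is proved by this seat; counts UNMOVED (typed 28∕28 · discharged 5∕28; 5∕27 excl.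
NODE O).  One finite four-torus programme at fixed ε — NOT ℝ⁴, NOT infinite volume, NOT OS, NOT a mass gap, NOT the Clay problem (R4 closes the conditional finite-𝕋⁴
rung `BalabanLadder.UV` only).  0 `def`; 0 `sorry`; standard axioms; no cite tags.
-/


noncomputable section

namespace Summit.QuantumFields.YangMills.BalabanUVNodes.N20HellingerRoadNullClasses

open Finset
open Literature.MathematicalPhysics.QuantumFieldTheory.Balaban1983to89
open T4MatchingAssembly (HybridNE7)
open Summit.QuantumFields.YangMills.BalabanUVNodes.N20HybridClassLawCharacterisation (exists_hybridNE7_of_target_of_classLawTV exists_tvRadius_of_hybridNE7)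
open Summit.QuantumFields.YangMills.BalabanUVNodes.N20HellingerRoadNullClassesKernel
  (totals_pos_of_twoSided target_of_endpointResponse_of_nonneg classLawTV_of_affinityDefect_of_nonneg exists_classLawTV_budget_lt_one_of_nonneg
    mixtureCurrentMoment_le_sq_of_boundedCurrent_of_nonneg)

variable {ι : Type*}

/-! ## §1 The three ∃-capstones for non-negative class weights [folklore + by-name] -/

section Road
variable {l₀ vol : ℝ} {T : ℕ → Finset ι} {A B : ℕ → ℝ → ι → ℝ}

/-- **★ THE HEAD IS NECESSARY: UNDER ANY HYBRID CERTIFICATE SOME CLASS IS LIVE UNDER BOTH RUNS AT EVERY KEY AND SOURCE** [folklore; dag-n20-w4's p609004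
`exists_tvRadius_of_hybridNE7`].  Non-negative class weights with positive totals on the window and `HybridNE7 l₀ vol T A B Bad W shA shB Wsh δ` with ANY dials ⇒
`∀ K t, |t| ≤ l₀ → ∃ σ ∈ T K, 0 < A K t σ ∧ 0 < B K t σ`: otherwise every run-B-live class is run-A-null, the run-B-null classes carry ALL of run A's mass and NONE of
run B's, and the class-law gap on them is `1 > ρ_K`.  So the head (L) of the road below is exactly what every certificate forces — asking it gives up nothing. -/
theorem twoSided_of_hybridNE7 [DecidableEq ι] {Bad : ℕ → ℝ → Finset ι} {W Wsh δ : ℕ → ℝ} {shA shB : ℕ → ℝ → ι → ℝ}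
    (h : HybridNE7 l₀ vol T A B Bad W shA shB Wsh δ)
    (hA0 : ∀ (K : ℕ) (t : ℝ), ∀ τ ∈ T K, 0 ≤ A K t τ) (hB0 : ∀ (K : ℕ) (t : ℝ), ∀ τ ∈ T K, 0 ≤ B K t τ)
    (hZA : ∀ (K : ℕ) (t : ℝ), |t| ≤ l₀ → 0 < ∑ τ ∈ T K, A K t τ) (hZB : ∀ (K : ℕ) (t : ℝ), |t| ≤ l₀ → 0 < ∑ τ ∈ T K, B K t τ) :
    ∀ (K : ℕ) (t : ℝ), |t| ≤ l₀ → ∃ σ ∈ T K, 0 < A K t σ ∧ 0 < B K t σ := by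
  obtain ⟨ρ, hρ, -, hTV⟩ := exists_tvRadius_of_hybridNE7 h hZA hZB
  intro K t ht
  by_contra hcon
  push Not at hcon
  -- `S` := the run-B-null classes; off `S` run B is live, hence (by `hcon`) run A is null
  set S := (T K).filter (fun τ => B K t τ = 0) with hSdef
  have hS : S ⊆ T K := filter_subset _ _
  have hqS : ∑ τ ∈ S, B K t τ = 0 := sum_eq_zero fun τ hτ => (mem_filter.1 hτ).2
  have hoff : ∑ τ ∈ T K \ S, A K t τ = 0 := sum_eq_zero fun τ hτ => by
    obtain ⟨hτT, hτS⟩ := mem_sdiff.1 hτ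
    have hBpos : 0 < B K t τ := lt_of_le_of_ne (hB0 K t τ hτT) fun h0 => hτS (mem_filter.2 ⟨hτT, h0.symm⟩)
    by_contra hA
    exact absurd (hcon τ hτT (lt_of_le_of_ne (hA0 K t τ hτT) (Ne.symm hA))) (not_le.2 hBpos)
  have hpS : ∑ τ ∈ S, A K t τ = ∑ τ ∈ T K, A K t τ := by rw [← sum_sdiff hS, hoff, zero_add]
  have key := hTV K t ht S hS
  rw [hpS, hqS, zero_div, sub_zero, div_self (hZA K t ht).ne', abs_one] at key
  linarith [(hρ K).2]

/-- **★★★ THE HELLINGER ROAD FROM ENDPOINT LETTERS, NON-NEGATIVE WEIGHTS, NO HEAD BUT THE TWO-SIDED LIVE CLASS** [folklore + by-name through p609004].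
Carriers `T K`; class weights `A, B ≥ 0` at EVERY source, DIFFERENTIABLE on the window `|s| ≤ l₀` (`0 ≤ l₀`, `0 < vol`) with carriers `A', B'`; at every `(K, t)` on the
window SOME class live under both runs; the E1∕E2 dictionary for `Z`; (H) `1 − Σ√(p q) ≤ η_K` with `Σ √η_K < ∞`; (R′) `|E_{q_{K,s}}[B'∕B − A'∕A]| ≤ R₁ K`, `Σ R₁ < ∞`;
(R‑c) `Σ ½(p+q)(A'∕A − m_{K,s})² ≤ χ` ⇒ `∃ Wsh shA shB`, `0 ≤ Wsh K ≤ √(2η_K)`, `Wsh K < 1`, and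
`HybridNE7 l₀ vol T A B (fun _ _ => ∅) (fun _ => 0) shA shB Wsh (K ↦ l₀·(R₁ K + 2√(2η_K)√χ)∕vol)` — null ∕ one-sided classes are absorbed by p609004's misfit shells. -/
theorem exists_hybridNE7_of_endpointLetters_noHead_of_nonneg [DecidableEq ι] (hl₀ : 0 ≤ l₀) (hvol : 0 < vol)
    (hA0 : ∀ (K : ℕ) (t : ℝ), ∀ τ ∈ T K, 0 ≤ A K t τ) (hB0 : ∀ (K : ℕ) (t : ℝ), ∀ τ ∈ T K, 0 ≤ B K t τ)
    (hlive : ∀ (K : ℕ) (t : ℝ), |t| ≤ l₀ → ∃ σ ∈ T K, 0 < A K t σ ∧ 0 < B K t σ)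
    {Z : ℕ → ℝ → ℝ} (hZA' : ∀ (K : ℕ) (t : ℝ), |t| ≤ l₀ → Z K t = ∑ τ ∈ T K, A K t τ)
    (hZB' : ∀ (K : ℕ) (t : ℝ), |t| ≤ l₀ → Z (K + 1) t = ∑ τ ∈ T K, B K t τ)
    {A' B' : ℕ → ℝ → ι → ℝ}
    (hdA : ∀ (K : ℕ) (s : ℝ), |s| ≤ l₀ → ∀ τ ∈ T K, HasDerivAt (fun u => A K u τ) (A' K s τ) s)
    (hdB : ∀ (K : ℕ) (s : ℝ), |s| ≤ l₀ → ∀ τ ∈ T K, HasDerivAt (fun u => B K u τ) (B' K s τ) s)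
    {η R₁ : ℕ → ℝ} {χ : ℝ} {m : ℕ → ℝ → ℝ}
    (hH : ∀ (K : ℕ) (t : ℝ), |t| ≤ l₀ →
      1 - ∑ τ ∈ T K, Real.sqrt ((A K t τ / ∑ σ ∈ T K, A K t σ) * (B K t τ / ∑ σ ∈ T K, B K t σ)) ≤ η K)
    (hηs : Summable fun K => Real.sqrt (η K))
    (hR : ∀ (K : ℕ) (s : ℝ), |s| ≤ l₀ →
      |∑ τ ∈ T K, B K s τ / (∑ σ ∈ T K, B K s σ) * (B' K s τ / B K s τ - A' K s τ / A K s τ)| ≤ R₁ K)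
    (hRs : Summable R₁)
    (hχ : ∀ (K : ℕ) (s : ℝ), |s| ≤ l₀ →
      ∑ τ ∈ T K, (A K s τ / (∑ σ ∈ T K, A K s σ) + B K s τ / (∑ σ ∈ T K, B K s σ)) / 2 * (A' K s τ / A K s τ - m K s) ^ 2 ≤ χ) :
    ∃ (Wsh : ℕ → ℝ) (shA shB : ℕ → ℝ → ι → ℝ),
      (∀ K, 0 ≤ Wsh K ∧ Wsh K ≤ Real.sqrt (2 * η K) ∧ Wsh K < 1) ∧
      HybridNE7 l₀ vol T A B (fun _ _ => ∅) (fun _ => 0) shA shB Wsh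
        (fun K => l₀ * (R₁ K + 2 * Real.sqrt (2 * η K) * Real.sqrt χ) / vol) := by
  have hZ := totals_pos_of_twoSided hA0 hB0 hlive
  have hZA : ∀ (K : ℕ) (t : ℝ), |t| ≤ l₀ → 0 < ∑ τ ∈ T K, A K t τ := fun K t ht => (hZ K ht).1
  have hZB : ∀ (K : ℕ) (t : ℝ), |t| ≤ l₀ → 0 < ∑ τ ∈ T K, B K t τ := fun K t ht => (hZ K ht).2
  have hTgt := target_of_endpointResponse_of_nonneg hl₀ hvol hA0 hB0 hZA hZB hZA' hZB' hdA hdB hH hR hχ hηs hRs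
  have hs2 : Summable fun K => Real.sqrt (2 * η K) := by
    have : (fun K => Real.sqrt (2 * η K)) = fun K => Real.sqrt 2 * Real.sqrt (η K) := by
      funext K; exact Real.sqrt_mul (by norm_num) _
    rw [this]; exact hηs.mul_left _
  have hTV := classLawTV_of_affinityDefect_of_nonneg hA0 hB0 hZA hZB hH
  -- continuity on the window from differentiability there
  have hIcc : ∀ {t : ℝ}, t ∈ Set.Icc (-l₀) l₀ → |t| ≤ l₀ := fun {t} ht => by rw [Set.mem_Icc] at ht; exact abs_le.2 ht
  have hcA : ∀ (K : ℕ), ∀ τ ∈ T K, ContinuousOn (fun t => A K t τ) (Set.Icc (-l₀) l₀) :=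
    fun K τ hτ t ht => (hdA K t (hIcc ht) τ hτ).continuousAt.continuousWithinAt
  have hcB : ∀ (K : ℕ), ∀ τ ∈ T K, ContinuousOn (fun t => B K t τ) (Set.Icc (-l₀) l₀) :=
    fun K τ hτ t ht => (hdB K t (hIcc ht) τ hτ).continuousAt.continuousWithinAt
  obtain ⟨ρ', hρ'0, hρ'le, hρ'1, hρ's, hρ'⟩ := exists_classLawTV_budget_lt_one_of_nonneg hl₀ hA0 hB0 hlive hcA hcB
    (fun K => Real.sqrt_nonneg _) hs2 hTV
  obtain ⟨shA, shB, hNE7⟩ := exists_hybridNE7_of_target_of_classLawTV hl₀ (fun K t _ τ hτ => hA0 K t τ hτ)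
    (fun K t _ τ hτ => hB0 K t τ hτ) hZA hZB hZA' hZB' hTgt hρ'0 hρ'1 hρ's hρ'
  exact ⟨ρ', shA, shB, fun K => ⟨hρ'0 K, hρ'le K, hρ'1 K⟩, hNE7⟩

/-- **★★★ FROM ANY (H) SUPPLIER IN THE ∃-SHAPE, NON-NEGATIVE WEIGHTS** [folklore].  The road of `exists_hybridNE7_of_endpointLetters_noHead_of_nonneg` with (H) as
`∃ η ≥ 0, Σ√η < ∞, ∀ K t, |t| ≤ l₀ → 1 − 𝒜_K(t) ≤ η_K` ⇒ `∃ η Wsh shA shB` with that letter, the budget bounds, and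
`HybridNE7 l₀ vol T A B (fun _ _ => ∅) (fun _ => 0) shA shB Wsh (K ↦ l₀·(R₁ K + 2√(2η_K)√χ)∕vol)`.  The socket shape of p623765, null classes allowed. -/
theorem exists_hybridNE7_of_affinityDefectLetter_and_response_of_nonneg [DecidableEq ι] (hl₀ : 0 ≤ l₀) (hvol : 0 < vol)
    (hA0 : ∀ (K : ℕ) (t : ℝ), ∀ τ ∈ T K, 0 ≤ A K t τ) (hB0 : ∀ (K : ℕ) (t : ℝ), ∀ τ ∈ T K, 0 ≤ B K t τ)
    (hlive : ∀ (K : ℕ) (t : ℝ), |t| ≤ l₀ → ∃ σ ∈ T K, 0 < A K t σ ∧ 0 < B K t σ)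
    {Z : ℕ → ℝ → ℝ} (hZA' : ∀ (K : ℕ) (t : ℝ), |t| ≤ l₀ → Z K t = ∑ τ ∈ T K, A K t τ)
    (hZB' : ∀ (K : ℕ) (t : ℝ), |t| ≤ l₀ → Z (K + 1) t = ∑ τ ∈ T K, B K t τ)
    {A' B' : ℕ → ℝ → ι → ℝ}
    (hdA : ∀ (K : ℕ) (s : ℝ), |s| ≤ l₀ → ∀ τ ∈ T K, HasDerivAt (fun u => A K u τ) (A' K s τ) s)
    (hdB : ∀ (K : ℕ) (s : ℝ), |s| ≤ l₀ → ∀ τ ∈ T K, HasDerivAt (fun u => B K u τ) (B' K s τ) s)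
    (hHex : ∃ η : ℕ → ℝ, (∀ K, 0 ≤ η K) ∧ Summable (fun K => Real.sqrt (η K)) ∧
      ∀ (K : ℕ) (t : ℝ), |t| ≤ l₀ →
        1 - ∑ τ ∈ T K, Real.sqrt ((A K t τ / ∑ σ ∈ T K, A K t σ) * (B K t τ / ∑ σ ∈ T K, B K t σ)) ≤ η K)
    {R₁ : ℕ → ℝ} {χ : ℝ} {m : ℕ → ℝ → ℝ}
    (hR : ∀ (K : ℕ) (s : ℝ), |s| ≤ l₀ →
      |∑ τ ∈ T K, B K s τ / (∑ σ ∈ T K, B K s σ) * (B' K s τ / B K s τ - A' K s τ / A K s τ)| ≤ R₁ K)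
    (hRs : Summable R₁)
    (hχ : ∀ (K : ℕ) (s : ℝ), |s| ≤ l₀ →
      ∑ τ ∈ T K, (A K s τ / (∑ σ ∈ T K, A K s σ) + B K s τ / (∑ σ ∈ T K, B K s σ)) / 2 * (A' K s τ / A K s τ - m K s) ^ 2 ≤ χ) :
    ∃ (η Wsh : ℕ → ℝ) (shA shB : ℕ → ℝ → ι → ℝ),
      (∀ (K : ℕ) (t : ℝ), |t| ≤ l₀ →
        1 - ∑ τ ∈ T K, Real.sqrt ((A K t τ / ∑ σ ∈ T K, A K t σ) * (B K t τ / ∑ σ ∈ T K, B K t σ)) ≤ η K) ∧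
      Summable (fun K => Real.sqrt (η K)) ∧
      (∀ K, 0 ≤ Wsh K ∧ Wsh K ≤ Real.sqrt (2 * η K) ∧ Wsh K < 1) ∧
      HybridNE7 l₀ vol T A B (fun _ _ => ∅) (fun _ => 0) shA shB Wsh
        (fun K => l₀ * (R₁ K + 2 * Real.sqrt (2 * η K) * Real.sqrt χ) / vol) := by
  obtain ⟨η, _, hηs, hH⟩ := hHex
  obtain ⟨Wsh, shA, shB, hW, hNE7⟩ := exists_hybridNE7_of_endpointLetters_noHead_of_nonneg hl₀ hvol hA0 hB0 hlive hZA' hZB' hdA hdB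
    hH hηs hR hRs hχ
  exact ⟨η, Wsh, shA, shB, hH, hηs, hW, hNE7⟩

/-- **★★ … WITH A BOUNDED CURRENT IN PLACE OF (R‑c), NON-NEGATIVE WEIGHTS** [folklore; p626582's socket, null classes allowed].  (R‑c) discharged by
`|A' K s τ| ≤ M·A K s τ` on `T K` (`0 ≤ M`) through §1's `mixtureCurrentMoment_le_sq_of_boundedCurrent_of_nonneg`; radius `K ↦ l₀·(R₁ K + 2√(2η_K)·M)∕vol`. -/
theorem exists_hybridNE7_of_affinityDefectLetter_response_boundedCurrent_of_nonneg [DecidableEq ι] (hl₀ : 0 ≤ l₀) (hvol : 0 < vol)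
    (hA0 : ∀ (K : ℕ) (t : ℝ), ∀ τ ∈ T K, 0 ≤ A K t τ) (hB0 : ∀ (K : ℕ) (t : ℝ), ∀ τ ∈ T K, 0 ≤ B K t τ)
    (hlive : ∀ (K : ℕ) (t : ℝ), |t| ≤ l₀ → ∃ σ ∈ T K, 0 < A K t σ ∧ 0 < B K t σ)
    {Z : ℕ → ℝ → ℝ} (hZA' : ∀ (K : ℕ) (t : ℝ), |t| ≤ l₀ → Z K t = ∑ τ ∈ T K, A K t τ)
    (hZB' : ∀ (K : ℕ) (t : ℝ), |t| ≤ l₀ → Z (K + 1) t = ∑ τ ∈ T K, B K t τ)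
    {A' B' : ℕ → ℝ → ι → ℝ}
    (hdA : ∀ (K : ℕ) (s : ℝ), |s| ≤ l₀ → ∀ τ ∈ T K, HasDerivAt (fun u => A K u τ) (A' K s τ) s)
    (hdB : ∀ (K : ℕ) (s : ℝ), |s| ≤ l₀ → ∀ τ ∈ T K, HasDerivAt (fun u => B K u τ) (B' K s τ) s)
    (hHex : ∃ η : ℕ → ℝ, (∀ K, 0 ≤ η K) ∧ Summable (fun K => Real.sqrt (η K)) ∧
      ∀ (K : ℕ) (t : ℝ), |t| ≤ l₀ →
        1 - ∑ τ ∈ T K, Real.sqrt ((A K t τ / ∑ σ ∈ T K, A K t σ) * (B K t τ / ∑ σ ∈ T K, B K t σ)) ≤ η K)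
    {R₁ : ℕ → ℝ} {M : ℝ} (hM : 0 ≤ M)
    (hR : ∀ (K : ℕ) (s : ℝ), |s| ≤ l₀ →
      |∑ τ ∈ T K, B K s τ / (∑ σ ∈ T K, B K s σ) * (B' K s τ / B K s τ - A' K s τ / A K s τ)| ≤ R₁ K)
    (hRs : Summable R₁)
    (hcur : ∀ (K : ℕ) (s : ℝ), |s| ≤ l₀ → ∀ τ ∈ T K, |A' K s τ| ≤ M * A K s τ) :
    ∃ (η Wsh : ℕ → ℝ) (shA shB : ℕ → ℝ → ι → ℝ),
      (∀ (K : ℕ) (t : ℝ), |t| ≤ l₀ →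
        1 - ∑ τ ∈ T K, Real.sqrt ((A K t τ / ∑ σ ∈ T K, A K t σ) * (B K t τ / ∑ σ ∈ T K, B K t σ)) ≤ η K) ∧
      Summable (fun K => Real.sqrt (η K)) ∧
      (∀ K, 0 ≤ Wsh K ∧ Wsh K ≤ Real.sqrt (2 * η K) ∧ Wsh K < 1) ∧
      HybridNE7 l₀ vol T A B (fun _ _ => ∅) (fun _ => 0) shA shB Wsh
        (fun K => l₀ * (R₁ K + 2 * Real.sqrt (2 * η K) * M) / vol) := by
  have hZ := totals_pos_of_twoSided hA0 hB0 hlive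
  have hχ : ∀ (K : ℕ) (s : ℝ), |s| ≤ l₀ →
      ∑ τ ∈ T K, (A K s τ / (∑ σ ∈ T K, A K s σ) + B K s τ / (∑ σ ∈ T K, B K s σ)) / 2
        * (A' K s τ / A K s τ - (fun (_ : ℕ) (_ : ℝ) => (0:ℝ)) K s) ^ 2 ≤ M ^ 2 :=
    fun K s hs => mixtureCurrentMoment_le_sq_of_boundedCurrent_of_nonneg hM (hA0 K s) (hB0 K s) (hZ K hs).1 (hZ K hs).2 (hcur K s hs)
  have h := exists_hybridNE7_of_affinityDefectLetter_and_response_of_nonneg hl₀ hvol hA0 hB0 hlive hZA' hZB' hdA hdB hHex hR hRs hχ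
  rwa [Real.sqrt_sq hM] at h

end Road

/-! ## §2 Toys (A6): one NULL class — the road of record's positivity letter fails, this file's road fires end to end [folklore] -/

section Toy

/-- [toy carriers] Two classes on `Bool`; run A: class `true` weighs `1`, class `false` weighs `(2^{−K})²`; run B: class `true` weighs `1 + (2^{−(K+1)})²`,
class `false` is NULL.  Source-constant.  The totals agree along `K` (`Z K = 1 + 4^{−K}`), so the E1∕E2 dictionary holds. -/
theorem toy_oldRoad_hB_fails :
    ¬ (∀ (K : ℕ) (t : ℝ), |t| ≤ (1:ℝ) → ∀ τ ∈ (Finset.univ : Finset Bool),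
        0 < (fun (K : ℕ) (_ : ℝ) (b : Bool) => if b then 1 + (((1:ℝ) / 2) ^ (K + 1)) ^ 2 else 0) K t τ) := by
  intro h
  have := h 0 0 (by simp) false (Finset.mem_univ _)
  simp at this

/-- **★ TOY — `HybridNE7` WITH A NULL CLASS, THROUGH THE WHOLE ROAD** (A6: every antecedent of `exists_hybridNE7_of_affinityDefectLetter_and_response_of_nonneg` met on
the two-class carrier of `toy_oldRoad_hB_fails` — non-negativity, the two-sided live class `true`, the dictionary `Z K = 1 + 4^{−K}`, zero source currents, (H) with
`η_K := 4^{−K}` (`1 − √(1∕(1+4^{−K})) ≤ 4^{−K}`, `Σ 2^{−K} < ∞`), (R′) and (R‑c) with `R₁ = 0`, `χ = 0`).  Not ex falso: the conclusion is exhibited. -/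
theorem toy_hybridNE7_oneNullClass :
    ∃ (η Wsh : ℕ → ℝ) (shA shB : ℕ → ℝ → Bool → ℝ),
      HybridNE7 1 1 (fun _ => (Finset.univ : Finset Bool))
        (fun (K : ℕ) (_ : ℝ) (b : Bool) => if b then (1:ℝ) else (((1:ℝ) / 2) ^ K) ^ 2)
        (fun (K : ℕ) (_ : ℝ) (b : Bool) => if b then 1 + (((1:ℝ) / 2) ^ (K + 1)) ^ 2 else 0)
        (fun _ _ => ∅) (fun _ => 0) shA shB Wsh (fun K => 1 * (0 + 2 * Real.sqrt (2 * η K) * Real.sqrt 0) / 1) := by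
  set A : ℕ → ℝ → Bool → ℝ := fun K _ b => if b then (1:ℝ) else (((1:ℝ) / 2) ^ K) ^ 2 with hAdef
  set B : ℕ → ℝ → Bool → ℝ := fun K _ b => if b then 1 + (((1:ℝ) / 2) ^ (K + 1)) ^ 2 else 0 with hBdef
  have hε0 : ∀ K : ℕ, 0 ≤ (((1:ℝ) / 2) ^ K) ^ 2 := fun K => sq_nonneg _
  have hA0 : ∀ (K : ℕ) (t : ℝ), ∀ τ ∈ (Finset.univ : Finset Bool), 0 ≤ A K t τ := by
    intro K t τ _; cases τ <;> simp [hAdef]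
  have hB0 : ∀ (K : ℕ) (t : ℝ), ∀ τ ∈ (Finset.univ : Finset Bool), 0 ≤ B K t τ := by
    intro K t τ _; cases τ
    · simp [hBdef]
    · simp [hBdef]; positivity
  have hlive : ∀ (K : ℕ) (t : ℝ), |t| ≤ (1:ℝ) → ∃ σ ∈ (Finset.univ : Finset Bool), 0 < A K t σ ∧ 0 < B K t σ :=
    fun K t _ => ⟨true, Finset.mem_univ _, by simp [hAdef], by simp [hBdef]; positivity⟩
  have hsumA : ∀ (K : ℕ) (t : ℝ), ∑ τ ∈ (Finset.univ : Finset Bool), A K t τ = 1 + (((1:ℝ) / 2) ^ K) ^ 2 := by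
    intro K t; simp [hAdef]
  have hsumB : ∀ (K : ℕ) (t : ℝ), ∑ τ ∈ (Finset.univ : Finset Bool), B K t τ = 1 + (((1:ℝ) / 2) ^ (K + 1)) ^ 2 := by
    intro K t; simp [hBdef]
  have hZA' : ∀ (K : ℕ) (t : ℝ), |t| ≤ (1:ℝ) → (fun K (_ : ℝ) => 1 + (((1:ℝ) / 2) ^ K) ^ 2) K t = ∑ τ ∈ (Finset.univ : Finset Bool), A K t τ :=
    fun K t _ => (hsumA K t).symm
  have hZB' : ∀ (K : ℕ) (t : ℝ), |t| ≤ (1:ℝ) →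
      (fun K (_ : ℝ) => 1 + (((1:ℝ) / 2) ^ K) ^ 2) (K + 1) t = ∑ τ ∈ (Finset.univ : Finset Bool), B K t τ :=
    fun K t _ => (hsumB K t).symm
  have hdA : ∀ (K : ℕ) (s : ℝ), |s| ≤ (1:ℝ) → ∀ τ ∈ (Finset.univ : Finset Bool),
      HasDerivAt (fun u => A K u τ) ((fun (_ : ℕ) (_ : ℝ) (_ : Bool) => (0:ℝ)) K s τ) s :=
    fun K s _ τ _ => by simpa [hAdef] using hasDerivAt_const s (A K s τ)
  have hdB : ∀ (K : ℕ) (s : ℝ), |s| ≤ (1:ℝ) → ∀ τ ∈ (Finset.univ : Finset Bool),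
      HasDerivAt (fun u => B K u τ) ((fun (_ : ℕ) (_ : ℝ) (_ : Bool) => (0:ℝ)) K s τ) s :=
    fun K s _ τ _ => by simpa [hBdef] using hasDerivAt_const s (B K s τ)
  -- (H) with `η_K := 4^{−K}`
  have hH : ∀ (K : ℕ) (t : ℝ), |t| ≤ (1:ℝ) →
      1 - ∑ τ ∈ (Finset.univ : Finset Bool), Real.sqrt ((A K t τ / ∑ σ ∈ (Finset.univ : Finset Bool), A K t σ)
        * (B K t τ / ∑ σ ∈ (Finset.univ : Finset Bool), B K t σ)) ≤ (((1:ℝ) / 2) ^ K) ^ 2 := by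
    intro K t _
    have hε : 0 ≤ (((1:ℝ) / 2) ^ K) ^ 2 := sq_nonneg _
    have hε' : 0 ≤ (((1:ℝ) / 2) ^ (K + 1)) ^ 2 := sq_nonneg _
    have hAt : A K t true = 1 := by simp [hAdef]
    have hBt : B K t true = 1 + (((1:ℝ) / 2) ^ (K + 1)) ^ 2 := by simp [hBdef]
    have hBf : B K t false = 0 := by simp [hBdef]
    have hsum : ∑ τ ∈ (Finset.univ : Finset Bool), Real.sqrt ((A K t τ / ∑ σ ∈ (Finset.univ : Finset Bool), A K t σ)
        * (B K t τ / ∑ σ ∈ (Finset.univ : Finset Bool), B K t σ)) = Real.sqrt (1 / (1 + (((1:ℝ) / 2) ^ K) ^ 2)) := by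
      rw [Fintype.sum_bool, hsumA K t, hsumB K t, hAt, hBt, hBf, zero_div, mul_zero, Real.sqrt_zero, add_zero,
        div_self (by positivity : (1 + (((1:ℝ) / 2) ^ (K + 1)) ^ 2) ≠ 0), mul_one]
    rw [hsum]
    -- `1 − √(1∕(1+ε)) ≤ 1 − 1∕(1+ε) = ε∕(1+ε) ≤ ε`
    have hx0 : 0 ≤ 1 / (1 + (((1:ℝ) / 2) ^ K) ^ 2) := by positivity
    have hx1 : 1 / (1 + (((1:ℝ) / 2) ^ K) ^ 2) ≤ 1 := by rw [div_le_one (by positivity)]; linarith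
    have h1 : 1 / (1 + (((1:ℝ) / 2) ^ K) ^ 2) ≤ Real.sqrt (1 / (1 + (((1:ℝ) / 2) ^ K) ^ 2)) :=
      calc 1 / (1 + (((1:ℝ) / 2) ^ K) ^ 2) = Real.sqrt ((1 / (1 + (((1:ℝ) / 2) ^ K) ^ 2)) ^ 2) := (Real.sqrt_sq hx0).symm
        _ ≤ Real.sqrt (1 / (1 + (((1:ℝ) / 2) ^ K) ^ 2)) := Real.sqrt_le_sqrt (by nlinarith)
    have h2 : 1 - 1 / (1 + (((1:ℝ) / 2) ^ K) ^ 2) = (((1:ℝ) / 2) ^ K) ^ 2 / (1 + (((1:ℝ) / 2) ^ K) ^ 2) := by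
      field_simp; ring
    have h3 : (((1:ℝ) / 2) ^ K) ^ 2 / (1 + (((1:ℝ) / 2) ^ K) ^ 2) ≤ (((1:ℝ) / 2) ^ K) ^ 2 := div_le_self hε (by linarith)
    linarith
  have hηs : Summable fun K : ℕ => Real.sqrt ((((1:ℝ) / 2) ^ K) ^ 2) := by
    have : (fun K : ℕ => Real.sqrt ((((1:ℝ) / 2) ^ K) ^ 2)) = fun K => ((1:ℝ) / 2) ^ K := by
      funext K; exact Real.sqrt_sq (pow_nonneg (by norm_num) K)
    rw [this]; exact summable_geometric_two
  have hHex : ∃ η : ℕ → ℝ, (∀ K, 0 ≤ η K) ∧ Summable (fun K => Real.sqrt (η K)) ∧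
      ∀ (K : ℕ) (t : ℝ), |t| ≤ (1:ℝ) →
        1 - ∑ τ ∈ (Finset.univ : Finset Bool), Real.sqrt ((A K t τ / ∑ σ ∈ (Finset.univ : Finset Bool), A K t σ)
          * (B K t τ / ∑ σ ∈ (Finset.univ : Finset Bool), B K t σ)) ≤ η K :=
    ⟨fun K => (((1:ℝ) / 2) ^ K) ^ 2, hε0, hηs, hH⟩
  -- the R-side: zero currents
  have hR : ∀ (K : ℕ) (s : ℝ), |s| ≤ (1:ℝ) →
      |∑ τ ∈ (Finset.univ : Finset Bool), B K s τ / (∑ σ ∈ (Finset.univ : Finset Bool), B K s σ)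
        * ((fun (_ : ℕ) (_ : ℝ) (_ : Bool) => (0:ℝ)) K s τ / B K s τ - (fun (_ : ℕ) (_ : ℝ) (_ : Bool) => (0:ℝ)) K s τ / A K s τ)|
        ≤ (fun _ => (0:ℝ)) K := by
    intro K s _; simp
  have hχ : ∀ (K : ℕ) (s : ℝ), |s| ≤ (1:ℝ) →
      ∑ τ ∈ (Finset.univ : Finset Bool), (A K s τ / (∑ σ ∈ (Finset.univ : Finset Bool), A K s σ)
        + B K s τ / (∑ σ ∈ (Finset.univ : Finset Bool), B K s σ)) / 2
        * ((fun (_ : ℕ) (_ : ℝ) (_ : Bool) => (0:ℝ)) K s τ / A K s τ - (fun (_ : ℕ) (_ : ℝ) => (0:ℝ)) K s) ^ 2 ≤ (0:ℝ) := by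
    intro K s _; simp
  obtain ⟨η, Wsh, shA, shB, -, -, -, hNE7⟩ :=
    exists_hybridNE7_of_affinityDefectLetter_and_response_of_nonneg (ι := Bool) (l₀ := 1) (vol := 1) zero_le_one one_pos hA0 hB0 hlive
      hZA' hZB' hdA hdB hHex hR summable_zero hχ
  exact ⟨η, Wsh, shA, shB, hNE7⟩

end Toy

end Summit.QuantumFields.YangMills.BalabanUVNodes.N20HellingerRoadNullClasses

end
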